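import Summits.ValiantsHypothesis.ValiantsHypothesis.Theorems.MonotoneRestorationOrbitRestorationQPResidueDefs
import Summits.ValiantsHypothesis.ValiantsHypothesis.Theorems.MonotoneRestorationOrbitRestorationQPFewTerms
import HarnessLib

/-!
# Route MonotoneRestoration — crux `OrbitRestorationQP` (stmt-ValiantsHypothesis-18293), line `depth-three-rung`:
# `A_∞` FROM THE NAMED WILD RESIDUE

With the vocabulary `GroupableUpTo` / `WildResidue` of `…OrbitRestorationQPResidueDefs.lean`, the kernel-checked reductions
`GroupedTerms.sigmaPiSigmaValue_of_wildResidue₄` and `FewTerms.sigmaPiSigmaValue_of_rankBound_of_wildResidue₅` read: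

* `sigmaPiSigmaValue_of_wildResidue_zero : WildResidue (fun _ => 0) → A_∞` (unconditional);
* `sigmaPiSigmaValue_of_rankBound_of_wildResidue : depthThree_rankBound → WildResidue id → A_∞` (granting the
  Saxena–Seshadhri rank bound, named Literature fact) and `…_le` for any budget `K ≤ id`;
* `groupableUpTo_mono`, `wildResidue_mono`, `threeKinds_of_groupableUpTo_zero` — bookkeeping.

Here `A_∞` is the registered stub `stub_sigmaPiSigmaValue`, quoted verbatim as the conclusion.  A planner re-registering the
rung's remaining content may therefore write `theorem stub_wildResidue : WildResidue id := …` (or budget `0`) and close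
`stub_sigmaPiSigmaValue` by name.  Nothing here proves the residue; VP ≠ VNP is not touched. [folklore]

## References
* N. Saxena, C. Seshadhri, *From Sylvester–Gallai configurations to rank bounds*, J. ACM 60 (2013), Thm 5. [SaxenaSeshadhri2013]
* A. Dawar, G. Wilsenach, *Symmetric arithmetic circuits*, ToC 21 (2025), §3.3. [DawarWilsenach2025]
-/

noncomputable section

open scoped Classical

-- `Summit.ValiantsHypothesis.ValiantsHypothesis.…` is the tree's single-conjunct layout (Sub = Summit).
set_option linter.dupNamespace false

namespace Summit.ValiantsHypothesis.ValiantsHypothesis.Theorems.OrbitRestorationQPDepthThreeRung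

namespace WildResidueThms

open MvPolynomial Equiv Finset Literature.Computability.AlgebraicComplexity Restorable

variable {n : ℕ}

/-- `GroupableUpTo` is monotone in the group-size budget `K`. [folklore] -/
theorem groupableUpTo_mono {K K' n c : ℕ} (hK : K ≤ K') {p : MvPolynomial (Fin n × Fin n) ℂ}
    (h : GroupableUpTo K n c p) : GroupableUpTo K' n c p := by
  obtain ⟨k, a, L, m, g, hdeg, hcard, hp, hgrp⟩ := h
  refine ⟨k, a, L, m, g, hdeg, hcard, hp, fun j => ?_⟩
  rcases hgrp j with hT | hS | hB | ⟨hms, hfew⟩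
  · exact Or.inl hT
  · exact Or.inr (Or.inl hS)
  · exact Or.inr (Or.inr (Or.inl hB))
  · exact Or.inr (Or.inr (Or.inr ⟨hms, hfew.trans hK⟩))

/-- **The wild residue is monotone in the group-size budget**: a residue that only promises restorability outside groupings
with larger kind-(K) groups is weaker. [folklore] -/
theorem wildResidue_mono {K K' : ℕ → ℕ} (hK : ∀ c, K c ≤ K' c) (h : WildResidue K) : WildResidue K' := by
  intro c
  obtain ⟨c', hc'⟩ := h c
  exact ⟨c', fun n p hsym hPD hng => hc' n p hsym hPD fun hg => hng (groupableUpTo_mono (hK c) hg)⟩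

/-- With group-size budget `0`, kind-(K) groups are empty and may be read as (vacuous) kind-(S) groups: `GroupableUpTo 0`
yields the three-kind grouping data of `GroupedTerms.qpOrbitRestorable_of_groupedTerms`. [folklore] -/
theorem threeKinds_of_groupableUpTo_zero {c : ℕ} {p : MvPolynomial (Fin n × Fin n) ℂ} (h : GroupableUpTo 0 n c p) :
    ∃ (k : ℕ) (a : Fin k → ℂ) (L : Fin k → Multiset (MvPolynomial (Fin n × Fin n) ℂ)) (m : ℕ) (g : Fin k → Fin m),
      (∀ i, ∀ ℓ ∈ L i, ℓ.totalDegree ≤ 1) ∧ (∀ i, Multiset.card (L i) ≤ n ^ c + c) ∧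
      p = ∑ i, MvPolynomial.C (a i) * (L i).prod ∧
      ∀ j : Fin m,
        ((∀ σ : Perm (Fin n), ren σ (∑ i ∈ univ.filter (fun i => g i = j), MvPolynomial.C (a i) * (L i).prod) =
            ∑ i ∈ univ.filter (fun i => g i = j), MvPolynomial.C (a i) * (L i).prod) ∧
          ∀ i, g i = j →
            (Set.range fun σ : Perm (Fin n) => (L i).map (ren σ)).ncard ≤ 2 ^ ((Nat.log 2 n + c) ^ c)) ∨
        (∀ i, g i = j → ∀ σ τ : Perm (Fin n), rename (fun q : Fin n × Fin n => (σ q.1, τ q.2))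
            (MvPolynomial.C (a i) * (L i).prod) = MvPolynomial.C (a i) * (L i).prod) ∨
        ((∀ σ τ : Perm (Fin n), rename (fun q : Fin n × Fin n => (σ q.1, τ q.2))
            (∑ i ∈ univ.filter (fun i => g i = j), MvPolynomial.C (a i) * (L i).prod) =
            ∑ i ∈ univ.filter (fun i => g i = j), MvPolynomial.C (a i) * (L i).prod) ∧
          (∑ i ∈ univ.filter (fun i => g i = j), ∏ ℓ ∈ (L i).toFinset, ((L i).count ℓ + 1)) ≤ n ^ c + c) := by
  obtain ⟨k, a, L, m, g, hdeg, hcard, hp, hgrp⟩ := h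
  refine ⟨k, a, L, m, g, hdeg, hcard, hp, fun j => ?_⟩
  rcases hgrp j with hT | hS | hB | ⟨-, hfew⟩
  · exact Or.inl hT
  · exact Or.inr (Or.inl hS)
  · exact Or.inr (Or.inr hB)
  · refine Or.inr (Or.inl fun i hi => ?_)
    have : i ∈ univ.filter (fun i => g i = j) := by simp [hi]
    have h0 : (univ.filter (fun i => g i = j)).card = 0 := Nat.le_zero.1 hfew
    rw [Finset.card_eq_zero] at h0
    rw [h0] at this
    exact absurd this (Finset.notMem_empty _)

/-- **WILD RESIDUE (budget `0`) ⇒ `A_∞`, unconditionally.**  The registered stub `stub_sigmaPiSigmaValue` of line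
`depth-three-rung` (conclusion verbatim) follows from `WildResidue (fun _ => 0)` by
`GroupedTerms.sigmaPiSigmaValue_of_wildResidue₄`. [folklore] -/
theorem sigmaPiSigmaValue_of_wildResidue_zero (hW : WildResidue fun _ => 0) :
    ∀ f : (n : ℕ) → MvPolynomial (Fin n × Fin n) ℂ, IsMatrixSymmetric f →
      (∃ c : ℕ, ∀ n : ℕ, PDClass (fun _ => 1) n c (f n)) →
      ∃ c : ℕ, ∀ n : ℕ, QPOrbitRestorable c n (f n) := by
  refine GroupedTerms.sigmaPiSigmaValue_of_wildResidue₄ fun c => ?_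
  obtain ⟨c', hc'⟩ := hW c
  refine ⟨c', fun n p hsym hPD hng => hc' n p hsym hPD fun hg => hng ?_⟩
  exact threeKinds_of_groupableUpTo_zero hg

/-- **`depthThree_rankBound` ∧ WILD RESIDUE (budget `c`) ⇒ `A_∞`.**  Granting the Saxena–Seshadhri rank bound (named Literature
fact, explicit hypothesis), the registered stub follows from `WildResidue id` by
`FewTerms.sigmaPiSigmaValue_of_rankBound_of_wildResidue₅`.  CONDITIONAL on `depthThree_rankBound`.
[folklore; cite: SaxenaSeshadhri2013, Theorem 5] -/
theorem sigmaPiSigmaValue_of_rankBound_of_wildResidue (hRB : depthThree_rankBound) (hW : WildResidue id) :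
    ∀ f : (n : ℕ) → MvPolynomial (Fin n × Fin n) ℂ, IsMatrixSymmetric f →
      (∃ c : ℕ, ∀ n : ℕ, PDClass (fun _ => 1) n c (f n)) →
      ∃ c : ℕ, ∀ n : ℕ, QPOrbitRestorable c n (f n) :=
  FewTerms.sigmaPiSigmaValue_of_rankBound_of_wildResidue₅ hRB fun c => hW c

/-- **Any budget**: `depthThree_rankBound → WildResidue K → A_∞` for every `K ≤ id` pointwise (monotonicity), in particular for
constant budgets. [folklore] -/
theorem sigmaPiSigmaValue_of_rankBound_of_wildResidue_le (hRB : depthThree_rankBound) {K : ℕ → ℕ} (hK : ∀ c, K c ≤ c)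
    (hW : WildResidue K) :
    ∀ f : (n : ℕ) → MvPolynomial (Fin n × Fin n) ℂ, IsMatrixSymmetric f →
      (∃ c : ℕ, ∀ n : ℕ, PDClass (fun _ => 1) n c (f n)) →
      ∃ c : ℕ, ∀ n : ℕ, QPOrbitRestorable c n (f n) :=
  sigmaPiSigmaValue_of_rankBound_of_wildResidue hRB (wildResidue_mono hK hW)

end WildResidueThms

end Summit.ValiantsHypothesis.ValiantsHypothesis.Theorems.OrbitRestorationQPDepthThreeRung

end
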